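import Mathlib

/-!
# Solo (blind) — the sign lemma and the travelling-wave sieve behind Theorem M′ / Corollary M″

Session s17 of the solo-blind residency on `NavierStokesRegularity` proved (on paper, HOME
`work/c69_monotonicity/M.md` §2bis) a single pointwise inequality for any would-be scale-monotone
slice functional `Θ_{G,w,α}` of 3D Navier–Stokes:

  `(I)   2 τ · N(x) ≤ (α+3) · G(x)`   for every datum, every point and every `τ ∈ (0, T_*)`,

where `G` is the top amplitude-degree part of the density at the 1-jet of the datum, `N` its Euler
rate and `T_* > 0` the hyperbolic lifespan (`= ∞` on the axisymmetric swirl-free class).  This file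
kernel-checks the elementary real-analysis passages that turn `(I)` into the corollaries:

* `sign_of_forall_small_tau`   : `τ ↓ 0` in `(I)` gives `0 ≤ (α+3)·G`   (SIGN LEMMA, Cor. M′1);
* `rate_le_of_forall_tau`      : `τ ↑ T_*` gives `2 T_* N ≤ (α+3) G`;
* `rate_nonpos_of_forall_tau`  : `T_* = ∞` gives `N ≤ 0`                 (Cor. M′2);
* `odd_nonneg_eq_zero`, `abs_odd_le_even` : a nonnegative function whose odd part is not dominated
  by its even part cannot exist; a nonnegative odd function vanishes (no odd-degree top density);
* `eq_zero_of_monotone_tendsto_zero` : a monotone function tending to `0` at `±∞` vanishes;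
* `sieve_of_dominated_deriv`  : if `|g₁'| ≤ g₃'` on `ℝ` and `g₁, g₃ → 0` at `±∞` then `g₃ ≡ 0`
  and `g₁ ≡ 0` — the mechanism of the TRAVELLING-WAVE SIEVE (Cor. M″): along axial lines of a
  smooth vortex ring the four parity components of `G ∘ jet` satisfy exactly this;
* `psd_form_zero_radical`, `psd_form_zero_add` : the zero set of a psd quadratic form is a linear
  subspace — the step of Cor. M2′ that upgrades "vanishes on the dipole-jet cone" to "vanishes on
  its span `ℝ³ ⊕ Sym₀`", leaving only `ωᵀBω`, which the enstrophy-production witness kills.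

Only propositional / real-variable content is formalised; the PDE statements stay on paper.
-/

set_option linter.dupNamespace false

namespace Summit.NavierStokesRegularity.NavierStokesRegularity.Theorems

open Filter Topology

/-- SIGN LEMMA (`τ ↓ 0` in the pointwise inequality (I)). -/
theorem sign_of_forall_small_tau {T N c G : ℝ} (hT : 0 < T)
    (h : ∀ τ : ℝ, 0 < τ → τ < T → 2 * τ * N ≤ c * G) : 0 ≤ c * G := by
  have hcont : Tendsto (fun τ : ℝ => 2 * τ * N) (𝓝[>] (0 : ℝ)) (𝓝 0) := by
    have h1 : Tendsto (fun τ : ℝ => 2 * τ * N) (𝓝 (0 : ℝ)) (𝓝 (2 * 0 * N)) :=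
      ((continuous_const.mul continuous_id).mul continuous_const).tendsto 0
    simp only [mul_zero, zero_mul] at h1
    exact h1.mono_left nhdsWithin_le_nhds
  have hev : ∀ᶠ τ in 𝓝[>] (0 : ℝ), 2 * τ * N ≤ c * G := by
    have hltT : ∀ᶠ τ in 𝓝[>] (0 : ℝ), τ < T :=
      (eventually_lt_nhds hT).filter_mono nhdsWithin_le_nhds
    have hpos : ∀ᶠ τ in 𝓝[>] (0 : ℝ), 0 < τ := eventually_nhdsWithin_of_forall fun τ hτ => hτ
    filter_upwards [hltT, hpos] with τ h1 h2 using h τ h2 h1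
  exact le_of_tendsto hcont hev

/-- `τ ↑ T` in (I): the rate bound with the full hyperbolic lifespan. -/
theorem rate_le_of_forall_tau {T N c G : ℝ} (hT : 0 < T)
    (h : ∀ τ : ℝ, 0 < τ → τ < T → 2 * τ * N ≤ c * G) : 2 * T * N ≤ c * G := by
  have hcont : Tendsto (fun τ : ℝ => 2 * τ * N) (𝓝[<] T) (𝓝 (2 * T * N)) :=
    (((continuous_const.mul continuous_id).mul continuous_const).tendsto T).mono_left
      nhdsWithin_le_nhds
  have hev : ∀ᶠ τ in 𝓝[<] T, 2 * τ * N ≤ c * G := by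
    have hpos : ∀ᶠ τ in 𝓝[<] T, 0 < τ :=
      (eventually_gt_nhds hT).filter_mono nhdsWithin_le_nhds
    have hlt : ∀ᶠ τ in 𝓝[<] T, τ < T := eventually_nhdsWithin_of_forall fun τ hτ => hτ
    filter_upwards [hpos, hlt] with τ h1 h2 using h τ h1 h2
  exact le_of_tendsto hcont hev

/-- `T_* = ∞` in (I): a rate bounded by `C/(2τ)` for every `τ > 0` is nonpositive (Cor. M′2). -/
theorem rate_nonpos_of_forall_tau {N C : ℝ} (h : ∀ τ : ℝ, 0 < τ → 2 * τ * N ≤ C) : N ≤ 0 := by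
  by_contra hN
  have hN' : 0 < N := not_le.mp hN
  have h2N : (2 : ℝ) * N ≠ 0 := by positivity
  set τ := (|C| + 1) / (2 * N) with hτdef
  have hτ : 0 < τ := by positivity
  have key := h τ hτ
  have hcalc : 2 * τ * N = |C| + 1 := by
    calc 2 * τ * N = (|C| + 1) * (2 * N) / (2 * N) := by rw [hτdef]; ring
      _ = |C| + 1 := mul_div_cancel_right₀ _ h2N
  linarith [le_abs_self C]

/-- No purely odd nonnegative top density (Cor. M′1(c)): odd + nonnegative ⇒ zero. -/
theorem odd_nonneg_eq_zero {E : Type*} [Neg E] (G : E → ℝ)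
    (hpos : ∀ j, 0 ≤ G j) (hodd : ∀ j, G (-j) = -G j) : ∀ j, G j = 0 := by
  intro j
  have h1 := hpos j
  have h2 := hpos (-j)
  rw [hodd] at h2
  linarith

/-- Cor. M′1(b): if `Gp + Gm ≥ 0` with `Gp` even and `Gm` odd then `|Gm| ≤ Gp` pointwise. -/
theorem abs_odd_le_even {E : Type*} [InvolutiveNeg E] (Gp Gm : E → ℝ)
    (h : ∀ j, 0 ≤ Gp j + Gm j) (hp : ∀ j, Gp (-j) = Gp j) (hm : ∀ j, Gm (-j) = -Gm j) :
    ∀ j, |Gm j| ≤ Gp j := by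
  intro j
  have h1 := h j
  have h2 := h (-j)
  rw [hp, hm] at h2
  exact abs_le.mpr ⟨by linarith, by linarith⟩

/-- A monotone function tending to `0` at both ends vanishes identically. -/
theorem eq_zero_of_monotone_tendsto_zero (f : ℝ → ℝ) (hf : Monotone f)
    (hbot : Tendsto f atBot (𝓝 0)) (htop : Tendsto f atTop (𝓝 0)) : ∀ x, f x = 0 := by
  intro x
  have hle : f x ≤ 0 :=
    ge_of_tendsto htop ((eventually_ge_atTop x).mono fun y hy => hf hy)
  have hge : 0 ≤ f x :=
    le_of_tendsto hbot ((eventually_le_atBot x).mono fun y hy => hf hy)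
  exact le_antisymm hle hge

/-- An antitone function tending to `0` at both ends vanishes identically. -/
theorem eq_zero_of_antitone_tendsto_zero (f : ℝ → ℝ) (hf : Antitone f)
    (hbot : Tendsto f atBot (𝓝 0)) (htop : Tendsto f atTop (𝓝 0)) : ∀ x, f x = 0 := by
  intro x
  have hge : 0 ≤ f x :=
    le_of_tendsto htop ((eventually_ge_atTop x).mono fun y hy => hf hy)
  have hle : f x ≤ 0 :=
    ge_of_tendsto hbot ((eventually_le_atBot x).mono fun y hy => hf hy)
  exact le_antisymm hle hge

/-- TRAVELLING-WAVE SIEVE (mechanism of Cor. M″). Along an axial line of a smooth travelling vortex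
ring, parity dominance of the pointwise Euler rates reads `|g₁'| ≤ g₃'` for the components
`g = G^{στ} ∘ jet`, all of which decay at `±∞`; then both vanish identically. -/
theorem sieve_of_dominated_deriv (g₁ g₃ : ℝ → ℝ)
    (h₁ : Differentiable ℝ g₁) (h₃ : Differentiable ℝ g₃)
    (hdom : ∀ x, |deriv g₁ x| ≤ deriv g₃ x)
    (h₁bot : Tendsto g₁ atBot (𝓝 0)) (h₃bot : Tendsto g₃ atBot (𝓝 0))
    (h₃top : Tendsto g₃ atTop (𝓝 0)) :
    (∀ x, g₃ x = 0) ∧ (∀ x, g₁ x = 0) := by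
  have hmono : Monotone g₃ :=
    monotone_of_deriv_nonneg h₃ (fun x => (abs_nonneg _).trans (hdom x))
  have hg₃ : ∀ x, g₃ x = 0 := eq_zero_of_monotone_tendsto_zero g₃ hmono h₃bot h₃top
  have hderiv₃ : ∀ x, deriv g₃ x = 0 := by
    have hfun : g₃ = fun _ => (0 : ℝ) := funext hg₃
    intro x
    rw [hfun]
    simp
  have hderiv₁ : ∀ x, deriv g₁ x = 0 := by
    intro x
    have hx := hdom x
    rw [hderiv₃ x] at hx
    exact abs_eq_zero.mp (le_antisymm hx (abs_nonneg _))
  have hconst : ∀ x y, g₁ x = g₁ y := is_const_of_deriv_eq_zero h₁ hderiv₁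
  refine ⟨hg₃, fun x => ?_⟩
  have hlim : Tendsto (fun _ : ℝ => g₁ x) atBot (𝓝 0) := h₁bot.congr (fun y => hconst y x)
  exact (tendsto_nhds_unique hlim tendsto_const_nhds).symm

/-- The sieve with the roles needed in Cor. M″: from `∂g_{-+} ≥ max |∂g_{στ}|` and decay, all four
parity components of the top density vanish along the line. -/
theorem sieve_four_parities (gpp gpm gmp gmm : ℝ → ℝ)
    (hpp : Differentiable ℝ gpp) (hpm : Differentiable ℝ gpm)
    (hmp : Differentiable ℝ gmp) (hmm : Differentiable ℝ gmm)
    (d1 : ∀ x, |deriv gpp x| ≤ deriv gmp x) (d2 : ∀ x, |deriv gpm x| ≤ deriv gmp x)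
    (d3 : ∀ x, |deriv gmm x| ≤ deriv gmp x)
    (bpp : Tendsto gpp atBot (𝓝 0)) (bpm : Tendsto gpm atBot (𝓝 0))
    (bmm : Tendsto gmm atBot (𝓝 0)) (bmp : Tendsto gmp atBot (𝓝 0))
    (tmp : Tendsto gmp atTop (𝓝 0)) :
    (∀ x, gmp x = 0) ∧ (∀ x, gpp x = 0) ∧ (∀ x, gpm x = 0) ∧ (∀ x, gmm x = 0) :=
  ⟨(sieve_of_dominated_deriv gpp gmp hpp hmp d1 bpp bmp tmp).1,
   (sieve_of_dominated_deriv gpp gmp hpp hmp d1 bpp bmp tmp).2,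
   (sieve_of_dominated_deriv gpm gmp hpm hmp d2 bpm bmp tmp).2,
   (sieve_of_dominated_deriv gmm gmp hmm hmp d3 bmm bmp tmp).2⟩

/-- Linear-algebra step of Cor. M2′ (degree 2): for a positive semidefinite symmetric bilinear form,
`Q v v = 0` forces `Q v w = 0` for every `w`; hence the zero set of a psd quadratic form is its
radical, a linear subspace, and a psd quadratic top density vanishing on the dipole-jet cone
vanishes on the linear span of that cone. -/
theorem psd_form_zero_radical {M : Type*} [AddCommGroup M] [Module ℝ M]
    (Q : M →ₗ[ℝ] M →ₗ[ℝ] ℝ) (hsymm : ∀ v w, Q v w = Q w v) (hpsd : ∀ v, 0 ≤ Q v v)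
    {v : M} (hv : Q v v = 0) (w : M) : Q v w = 0 := by
  have key : ∀ t : ℝ, 0 ≤ Q w w * (t * t) + (2 * Q v w) * t + 0 := by
    intro t
    have h := hpsd (v + t • w)
    simp only [map_add, map_smul, LinearMap.add_apply, LinearMap.smul_apply, smul_eq_mul] at h
    rw [hsymm w v, hv] at h
    linarith
  have hdisc := discrim_le_zero key
  have hsq : (2 * Q v w) ^ 2 ≤ 0 := by
    simp only [discrim, mul_zero, sub_zero] at hdisc
    exact hdisc
  have h2 : 2 * Q v w = 0 := (pow_eq_zero_iff two_ne_zero).mp (le_antisymm hsq (sq_nonneg _))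
  linarith

/-- Consequence used in Cor. M2′: a psd quadratic form vanishing on a set vanishes on sums of its
elements (and, with `map_smul`, on the whole linear span). -/
theorem psd_form_zero_add {M : Type*} [AddCommGroup M] [Module ℝ M]
    (Q : M →ₗ[ℝ] M →ₗ[ℝ] ℝ) (hsymm : ∀ v w, Q v w = Q w v) (hpsd : ∀ v, 0 ≤ Q v v)
    {v w : M} (hv : Q v v = 0) (hw : Q w w = 0) : Q (v + w) (v + w) = 0 := by
  have h1 := psd_form_zero_radical Q hsymm hpsd hv w
  have h2 := psd_form_zero_radical Q hsymm hpsd hw v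
  simp only [map_add, LinearMap.add_apply, hv, hw, h1, h2, add_zero]

end Summit.NavierStokesRegularity.NavierStokesRegularity.Theorems
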